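import Summits.RiemannHypothesis.RiemannHypothesis.Theorems.UniversalFactorMediumYSums

/-!
# RiemannHypothesis / UniversalFactor — soundness of the box and cover checks (soundness, VI)

Route `RiemannHypothesis/UniversalFactor`, crux `MediumKernelNoGo` (stmt-RiemannHypothesis-2577), line
`one-sided-average-sign-test`.  `osaSide_bound`: for every `a` of a box, `S·∫₀^∞ Re H_0(x+σy)e^{−ay}dy`
lies in `[P.lo − eP − tP, P.hi + eP + tP]` (side sum, quadrature error, tail); `osaBoxCheck_sound`: a
passing box gives a filled dip (`H_0(x) < 0 < P, Q`) or hump (`H_0(x) > 0 > P, Q`) of the crux's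
one-sided Laplace averages at `x = xn/xd` for every `a ∈ [A₁/AD, A₂/AD]`; `osaCoverCheck_sound`:
a passing cover of consecutive boxes gives it for every `a` of the window.  Registered sub-goal:
`stub_osaCoverFind` (consecutive boxes cover the window).
-/

set_option linter.dupNamespace false

noncomputable section

namespace Summit.RiemannHypothesis.RiemannHypothesis.Theorems

open MeasureTheory Set
open Literature.NumberTheory.LFunctions
open Literature.Analysis.ValidatedNumerics Literature.Analysis.ValidatedNumerics.NumericsMP

/-! ## One side of a box -/

/-- The sanity predicate of a point, unpacked. [folklore] -/
theorem UniversalFactor.OsaPoint.ok_iff (pt : UniversalFactor.OsaPoint) : pt.ok = true ↔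
    (0 < pt.xd ∧ 0 < pt.rhoYn ∧ 0 < pt.rhoYd ∧ 0 < pt.RYd ∧ pt.RYn ≤ 12 * pt.RYd ∧
      pt.rhoYn * pt.RYd < pt.RYn * pt.rhoYd) := by
  simp only [UniversalFactor.OsaPoint.ok, decide_eq_true_eq]

/-- `osaCeilQ S q ≥ q · S`. [folklore] -/
theorem UniversalFactor.le_osaCeilQ (S : ℕ) (q : ℚ) : ((q : ℚ) : ℝ) * S ≤ (UniversalFactor.osaCeilQ S q : ℝ) := by
  unfold UniversalFactor.osaCeilQ
  have hc := Numerics.le_cdiv_mul_real (a := q.num * S) (b := q.den) (by exact_mod_cast q.den_pos)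
  have hden : (0:ℝ) < q.den := by exact_mod_cast q.den_pos
  rw [Rat.cast_def q, div_mul_eq_mul_div, div_le_iff₀ hden]
  push_cast at hc ⊢
  exact hc

/-- **One side of a box**: for every `a` of the box, `S · ∫₀^∞ Re H_0(x + σy) e^{−ay} dy` lies in
`[P.lo − eP − tP, P.hi + eP + tP]`. [folklore] -/
theorem UniversalFactor.osaSide_bound
    (hH0 : (∀ z : ℂ, ‖deBruijnH 0 z‖ ≤ ∫ u in Ioi (0:ℝ), deBruijnPhi u * Real.cosh (z.im * u)) ∧
      IntegrableOn (fun u : ℝ => deBruijnPhi u * Real.cosh (12 * u)) (Ioi 0) ∧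
      (∫ u in Ioi (0:ℝ), deBruijnPhi u * Real.cosh (12 * u)) ≤ 5)
    {C : UniversalFactor.OsaCtx} (hV : C.Valid) (pt : UniversalFactor.OsaPoint) (hok : pt.ok = true)
    {σ : ℝ} (hσ : |σ| ≤ 1) {Cy : ℕ} {vals : Array MI}
    (hvals : ∀ i' < 32 * Cy, MI.mem C.S (deBruijnH 0 ((((pt.xn : ℝ) / pt.xd + σ *
          ((2 * (i' / 32 : ℕ) + 1) * ((pt.rhoYn : ℝ) / pt.rhoYd) +
            (pt.rhoYn : ℝ) / pt.rhoYd * UniversalFactor.osaNodeR (i' % 32)) : ℝ)) : ℂ)).re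
          (vals.getD i' (MI.ofInt C.S 0)))
    {A₁ A₂ AD : ℕ} (hA : 0 < A₁) (hAD : 0 < AD) {a : ℝ} (ha1 : (A₁ : ℝ) / AD ≤ a) (ha2 : a ≤ (A₂ : ℝ) / AD)
    {W : Array MI × Array MI × Array MI × Array MI} (hW : UniversalFactor.osaWTabs C pt A₁ A₂ AD Cy = some W)
    {eP : ℤ} (heP : UniversalFactor.osaSideErr C pt A₁ A₂ AD (UniversalFactor.osaCeilQ C.S
      (UniversalFactor.osaDefectQ ((pt.rhoYn : ℚ) / pt.rhoYd) ((pt.RYn : ℚ) / pt.RYd))) Cy 0 0 = some eP)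
    {tP : ℤ} (htP : UniversalFactor.osaTailBound C pt A₁ AD Cy = some tP) :
    ((UniversalFactor.osaSideSum C pt vals W (32 * Cy) 0 (MI.ofInt C.S 0)).lo : ℝ) - eP - tP ≤
        (∫ y in Ioi (0:ℝ), (deBruijnH 0 ((((pt.xn : ℝ) / pt.xd + σ * y : ℝ)) : ℂ)).re * Real.exp (-(a * y))) * C.S ∧
      (∫ y in Ioi (0:ℝ), (deBruijnH 0 ((((pt.xn : ℝ) / pt.xd + σ * y : ℝ)) : ℂ)).re * Real.exp (-(a * y))) * C.S ≤
        ((UniversalFactor.osaSideSum C pt vals W (32 * Cy) 0 (MI.ofInt C.S 0)).hi : ℝ) + eP + tP := by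
  obtain ⟨hxd, hyn, hyd, hRd, hR12, hρR⟩ := (UniversalFactor.OsaPoint.ok_iff pt).1 hok
  set x : ℝ := (pt.xn : ℝ) / pt.xd with hx
  set ρ : ℝ := (pt.rhoYn : ℝ) / pt.rhoYd with hρ
  set R : ℝ := (pt.RYn : ℝ) / pt.RYd with hR
  have hρ0 : 0 < ρ := by positivity
  have hρR' : ρ < R := by
    rw [hρ, hR, div_lt_div_iff₀ (by exact_mod_cast hyd) (by exact_mod_cast hRd)]; exact_mod_cast hρR
  have hR12' : R ≤ 12 := by
    rw [hR, div_le_iff₀ (by exact_mod_cast hRd)]; exact_mod_cast hR12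
  have hA' : (0:ℝ) < (A₁ : ℝ) / AD := by positivity
  have ha0 : 0 < a := lt_of_lt_of_le hA' ha1
  have hS := hV.hS
  have hSr : (0:ℝ) < C.S := by exact_mod_cast hS
  -- the GL sums
  have hsum := UniversalFactor.osaSideSum_inv hV pt hyn hyd σ vals hAD ha1 ha2 hW hvals (32 * Cy) 0 (by omega)
    (MI.mem_ofInt C.S 0)
  simp only [Int.cast_zero, zero_add, ← Finset.range_eq_Ico] at hsum
  rw [UniversalFactor.osa_sum_flat (fun c j => ρ * UniversalFactor.osaWeightR j *
      ((deBruijnH 0 (((x + σ * ((2 * c + 1) * ρ + ρ * UniversalFactor.osaNodeR j) : ℝ)) : ℂ)).re *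
        Real.exp (-(a * ((2 * c + 1) * ρ + ρ * UniversalFactor.osaNodeR j)))))] at hsum
  -- the analytic side
  have hdec := UniversalFactor.osaSide_decomp (x := x) (σ := σ) ha0 ρ Cy
  have hcells : ∀ c ∈ Finset.range Cy,
      |(∫ y in (2 * c * ρ)..(2 * (c + 1) * ρ), (deBruijnH 0 (((x + σ * y : ℝ)) : ℂ)).re * Real.exp (-(a * y))) -
          ∑ j ∈ Finset.range 32, ρ * UniversalFactor.osaWeightR j *
            ((deBruijnH 0 (((x + σ * ((2 * c + 1) * ρ + ρ * UniversalFactor.osaNodeR j) : ℝ)) : ℂ)).re *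
              Real.exp (-(a * ((2 * c + 1) * ρ + ρ * UniversalFactor.osaNodeR j))))| ≤
        5 * Real.exp (-(a * ((2 * c + 1) * ρ - R))) * UniversalFactor.osaDefectR ρ R :=
    fun c _ => UniversalFactor.osaSide_cell_error hH0 hσ ha0.le hρ0.le hρR' hR12' c
  have htail := UniversalFactor.osaSide_tail (x := x) (σ := σ) ha0 (2 * Cy * ρ)
  -- the error terms
  have hD0 : 0 ≤ UniversalFactor.osaDefectR ρ R := UniversalFactor.osaDefectR_nonneg hρ0.le hρR'
  have hdS : UniversalFactor.osaDefectR ρ R * C.S ≤ (UniversalFactor.osaCeilQ C.S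
      (UniversalFactor.osaDefectQ ((pt.rhoYn : ℚ) / pt.rhoYd) ((pt.RYn : ℚ) / pt.RYd)) : ℝ) := by
    have := UniversalFactor.le_osaCeilQ C.S (UniversalFactor.osaDefectQ ((pt.rhoYn : ℚ) / pt.rhoYd) ((pt.RYn : ℚ) / pt.RYd))
    rw [UniversalFactor.osaDefectQ_cast] at this
    push_cast at this
    exact this
  have herr := UniversalFactor.osaSideErr_inv hV pt hAD ha1 ha2 hD0 hdS Cy 0 0 heP
  simp only [zero_add, ← Finset.range_eq_Ico, Int.cast_zero, sub_zero] at herr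
  have htb := UniversalFactor.le_osaTailBound hV pt hA hAD htP
  have htail' : Real.exp (-(a * (2 * Cy * ρ))) / a ≤
      Real.exp (-((A₁ : ℝ) / AD * (2 * Cy * ((pt.rhoYn : ℝ) / pt.rhoYd)))) / ((A₁ : ℝ) / AD) := by
    rw [← hρ]
    have hY : 0 ≤ 2 * Cy * ρ := by positivity
    have e1 : Real.exp (-(a * (2 * Cy * ρ))) ≤ Real.exp (-((A₁ : ℝ) / AD * (2 * Cy * ρ))) :=
      Real.exp_le_exp.2 (by nlinarith)
    calc Real.exp (-(a * (2 * Cy * ρ))) / a ≤ Real.exp (-((A₁ : ℝ) / AD * (2 * Cy * ρ))) / a :=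
          div_le_div_of_nonneg_right e1 ha0.le
      _ ≤ _ := div_le_div_of_nonneg_left (Real.exp_pos _).le hA' ha1
  -- assemble
  set I : ℝ := ∫ y in Ioi (0:ℝ), (deBruijnH 0 (((x + σ * y : ℝ)) : ℂ)).re * Real.exp (-(a * y)) with hI
  set G : ℝ := ∑ c ∈ Finset.range Cy, ∑ j ∈ Finset.range 32, ρ * UniversalFactor.osaWeightR j *
      ((deBruijnH 0 (((x + σ * ((2 * c + 1) * ρ + ρ * UniversalFactor.osaNodeR j) : ℝ)) : ℂ)).re *
        Real.exp (-(a * ((2 * c + 1) * ρ + ρ * UniversalFactor.osaNodeR j)))) with hG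
  have hdiff : |I - G| * C.S ≤ eP + tP := by
    have e1 : I - G = ∑ c ∈ Finset.range Cy,
        ((∫ y in (2 * c * ρ)..(2 * (c + 1) * ρ), (deBruijnH 0 (((x + σ * y : ℝ)) : ℂ)).re * Real.exp (-(a * y))) -
          ∑ j ∈ Finset.range 32, ρ * UniversalFactor.osaWeightR j *
            ((deBruijnH 0 (((x + σ * ((2 * c + 1) * ρ + ρ * UniversalFactor.osaNodeR j) : ℝ)) : ℂ)).re *
              Real.exp (-(a * ((2 * c + 1) * ρ + ρ * UniversalFactor.osaNodeR j))))) +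
        ∫ y in Ioi (2 * Cy * ρ), (deBruijnH 0 (((x + σ * y : ℝ)) : ℂ)).re * Real.exp (-(a * y)) := by
      rw [hdec, hG, Finset.sum_sub_distrib]; ring
    rw [e1]
    have h1 := (abs_add_le _ _).trans (add_le_add ((Finset.abs_sum_le_sum_abs _ _).trans (Finset.sum_le_sum hcells))
      (htail.trans htail'))
    have h2 := mul_le_mul_of_nonneg_right h1 hSr.le
    rw [add_mul] at h2
    have h3 : (∑ i ∈ Finset.range Cy, 5 * Real.exp (-(a * ((2 * i + 1) * ρ - R))) * UniversalFactor.osaDefectR ρ R) *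
        C.S ≤ eP := by
      convert herr using 4
    linarith
  have habs' : |I * C.S - G * C.S| ≤ eP + tP := by rw [← sub_mul, abs_mul, abs_of_pos hSr]; exact hdiff
  have habs := abs_le.1 habs'
  have hlo := hsum.1
  have hhi := hsum.2
  constructor
  · linarith [habs.1]
  · linarith [habs.2]

/-! ## The box check -/

/-- The crux's backward average is the `σ = −1` side integral. [folklore] -/
theorem UniversalFactor.osa_P_eq (x a : ℝ) :
    (∫ y in Ioi (0:ℝ), deBruijnH 0 ((x : ℂ) - y) * (Real.exp (-(a * y)) : ℂ)).re =
      ∫ y in Ioi (0:ℝ), (deBruijnH 0 (((x + (-1) * y : ℝ)) : ℂ)).re * Real.exp (-(a * y)) := by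
  rw [← UniversalFactor.osaSide_re_eq x (-1) a]
  congr 1
  refine setIntegral_congr_fun measurableSet_Ioi fun y _ => ?_
  congr 2
  push_cast; ring

/-- The crux's forward average is the `σ = 1` side integral. [folklore] -/
theorem UniversalFactor.osa_Q_eq (x a : ℝ) :
    (∫ y in Ioi (0:ℝ), deBruijnH 0 ((x : ℂ) + y) * (Real.exp (-(a * y)) : ℂ)).re =
      ∫ y in Ioi (0:ℝ), (deBruijnH 0 (((x + 1 * y : ℝ)) : ℂ)).re * Real.exp (-(a * y)) := by
  rw [← UniversalFactor.osaSide_re_eq x 1 a]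
  congr 1
  refine setIntegral_congr_fun measurableSet_Ioi fun y _ => ?_
  congr 2
  push_cast; ring

/-- **Soundness of the box check**: a passing box gives, for every `a` of the box, a filled dip or a
hump of the one-sided averages at `x = xn/xd`. [folklore] -/
theorem UniversalFactor.osaBoxCheck_sound
    (hH0 : (∀ z : ℂ, ‖deBruijnH 0 z‖ ≤ ∫ u in Ioi (0:ℝ), deBruijnPhi u * Real.cosh (z.im * u)) ∧
      IntegrableOn (fun u : ℝ => deBruijnPhi u * Real.cosh (12 * u)) (Ioi 0) ∧
      (∫ u in Ioi (0:ℝ), deBruijnPhi u * Real.cosh (12 * u)) ≤ 5)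
    {C : UniversalFactor.OsaCtx} (hV : C.Valid) (pt : UniversalFactor.OsaPoint) (hok : pt.ok = true)
    {hx : MI} (hhx : MI.mem C.S (deBruijnH 0 ((((pt.xn : ℝ) / pt.xd : ℝ)) : ℂ)).re hx)
    {valsB valsF : Array MI}
    (hvB : ∀ i' < 32 * pt.CyB, MI.mem C.S (deBruijnH 0 ((((pt.xn : ℝ) / pt.xd + (-1) *
          ((2 * (i' / 32 : ℕ) + 1) * ((pt.rhoYn : ℝ) / pt.rhoYd) +
            (pt.rhoYn : ℝ) / pt.rhoYd * UniversalFactor.osaNodeR (i' % 32)) : ℝ)) : ℂ)).re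
          (valsB.getD i' (MI.ofInt C.S 0)))
    (hvF : ∀ i' < 32 * pt.CyF, MI.mem C.S (deBruijnH 0 ((((pt.xn : ℝ) / pt.xd + 1 *
          ((2 * (i' / 32 : ℕ) + 1) * ((pt.rhoYn : ℝ) / pt.rhoYd) +
            (pt.rhoYn : ℝ) / pt.rhoYd * UniversalFactor.osaNodeR (i' % 32)) : ℝ)) : ℂ)).re
          (valsF.getD i' (MI.ofInt C.S 0)))
    {A₁ A₂ AD : ℕ} (hA : 0 < A₁) (hAD : 0 < AD)
    (hchk : UniversalFactor.osaBoxCheck C pt hx valsB valsF A₁ A₂ AD = true)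
    {a : ℝ} (ha1 : (A₁ : ℝ) / AD ≤ a) (ha2 : a ≤ (A₂ : ℝ) / AD) :
    ((deBruijnH 0 (((pt.xn : ℝ) / pt.xd : ℝ) : ℂ)).re < 0 ∧
        0 < (∫ y in Ioi (0:ℝ), deBruijnH 0 ((((pt.xn : ℝ) / pt.xd : ℝ) : ℂ) - y) * (Real.exp (-(a * y)) : ℂ)).re ∧
        0 < (∫ y in Ioi (0:ℝ), deBruijnH 0 ((((pt.xn : ℝ) / pt.xd : ℝ) : ℂ) + y) * (Real.exp (-(a * y)) : ℂ)).re) ∨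
      (0 < (deBruijnH 0 (((pt.xn : ℝ) / pt.xd : ℝ) : ℂ)).re ∧
        (∫ y in Ioi (0:ℝ), deBruijnH 0 ((((pt.xn : ℝ) / pt.xd : ℝ) : ℂ) - y) * (Real.exp (-(a * y)) : ℂ)).re < 0 ∧
        (∫ y in Ioi (0:ℝ), deBruijnH 0 ((((pt.xn : ℝ) / pt.xd : ℝ) : ℂ) + y) * (Real.exp (-(a * y)) : ℂ)).re < 0) := by
  have hS := hV.hS
  have hSr : (0:ℝ) < C.S := by exact_mod_cast hS
  rw [UniversalFactor.osa_P_eq, UniversalFactor.osa_Q_eq]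
  unfold UniversalFactor.osaBoxCheck at hchk
  dsimp only at hchk
  split at hchk
  · rename_i WB WF eP eQ tP tQ hWB hWF heP heQ htP htQ
    have hPb := UniversalFactor.osaSide_bound hH0 hV pt hok (σ := -1) (by norm_num) hvB hA hAD ha1 ha2 hWB heP htP
    have hQb := UniversalFactor.osaSide_bound hH0 hV pt hok (σ := 1) (by norm_num) hvF hA hAD ha1 ha2 hWF heQ htQ
    set P : MI := UniversalFactor.osaSideSum C pt valsB WB (32 * pt.CyB) 0 (MI.ofInt C.S 0) with hPdef
    set Q : MI := UniversalFactor.osaSideSum C pt valsF WF (32 * pt.CyF) 0 (MI.ofInt C.S 0) with hQdef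
    split at hchk
    · simp only [decide_eq_true_eq] at hchk
      obtain ⟨h1, h2, h3⟩ := hchk
      left
      refine ⟨MI.neg_of_hi_neg hhx h1, ?_, ?_⟩
      · have : (0:ℝ) < (P.lo : ℝ) - eP - tP := by
          have : ((eP + tP : ℤ) : ℝ) < (P.lo : ℝ) := by exact_mod_cast h2
          push_cast at this; linarith
        exact pos_of_mul_pos_left (this.trans_le hPb.1) hSr.le
      · have : (0:ℝ) < (Q.lo : ℝ) - eQ - tQ := by
          have : ((eQ + tQ : ℤ) : ℝ) < (Q.lo : ℝ) := by exact_mod_cast h3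
          push_cast at this; linarith
        exact pos_of_mul_pos_left (this.trans_le hQb.1) hSr.le
    · simp only [decide_eq_true_eq] at hchk
      obtain ⟨h1, h2, h3⟩ := hchk
      right
      refine ⟨MI.pos_of_lo_pos hhx h1, ?_, ?_⟩
      · have : (P.hi : ℝ) + eP + tP < 0 := by
          have : ((P.hi + eP + tP : ℤ) : ℝ) < ((0 : ℤ) : ℝ) := by exact_mod_cast h2
          push_cast at this; linarith
        have := hPb.2.trans_lt this
        exact neg_of_mul_neg_left this hSr.le
      · have : (Q.hi : ℝ) + eQ + tQ < 0 := by
          have : ((Q.hi + eQ + tQ : ℤ) : ℝ) < ((0 : ℤ) : ℝ) := by exact_mod_cast h3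
          push_cast at this; linarith
        have := hQb.2.trans_lt this
        exact neg_of_mul_neg_left this hSr.le
  · simp at hchk

/-! ## Points, boxes and the cover -/

/-- **Point data soundness**: `H_0(x)` and the node values of both sides are enclosed. [folklore] -/
theorem UniversalFactor.osaPointData_sound {C : UniversalFactor.OsaCtx} (hV : C.Valid) (pt : UniversalFactor.OsaPoint)
    (hok : pt.ok = true) {d : MI × Array MI × Array MI} (h : UniversalFactor.osaPointData C pt = some d) :
    MI.mem C.S (deBruijnH 0 ((((pt.xn : ℝ) / pt.xd : ℝ)) : ℂ)).re d.1 ∧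
    (∀ i' < 32 * pt.CyB, MI.mem C.S (deBruijnH 0 ((((pt.xn : ℝ) / pt.xd + (-1) *
          ((2 * (i' / 32 : ℕ) + 1) * ((pt.rhoYn : ℝ) / pt.rhoYd) +
            (pt.rhoYn : ℝ) / pt.rhoYd * UniversalFactor.osaNodeR (i' % 32)) : ℝ)) : ℂ)).re
          (d.2.1.getD i' (MI.ofInt C.S 0))) ∧
    (∀ i' < 32 * pt.CyF, MI.mem C.S (deBruijnH 0 ((((pt.xn : ℝ) / pt.xd + 1 *
          ((2 * (i' / 32 : ℕ) + 1) * ((pt.rhoYn : ℝ) / pt.rhoYd) +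
            (pt.rhoYn : ℝ) / pt.rhoYd * UniversalFactor.osaNodeR (i' % 32)) : ℝ)) : ℂ)).re
          (d.2.2.getD i' (MI.ofInt C.S 0))) := by
  obtain ⟨hxd, hyn, hyd, -, -, -⟩ := (UniversalFactor.OsaPoint.ok_iff pt).1 hok
  unfold UniversalFactor.osaPointData at h
  split at h
  · rename_i hx vB vF hhx hvB hvF
    simp only [Option.some.injEq] at h
    subst h
    have h1 := UniversalFactor.mem_osaH0 hV hxd hhx
    have h2 := UniversalFactor.osaNodeVals_inv hV pt hxd hyd true (32 * pt.CyB) 0 #[] hvB rfl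
      (fun i' hi' => absurd hi' (by omega))
    have h3 := UniversalFactor.osaNodeVals_inv hV pt hxd hyd false (32 * pt.CyF) 0 #[] hvF rfl
      (fun i' hi' => absurd hi' (by omega))
    simp only [if_true, zero_add] at h2
    simp only [Bool.false_eq_true, if_false, zero_add] at h3
    exact ⟨h1, h2.2, h3.2⟩
  · simp at h

/-- The list of point data agrees with `osaPointData` entrywise. [folklore] -/
theorem UniversalFactor.osaAllPointData_get {C : UniversalFactor.OsaCtx} :
    ∀ (pts : List UniversalFactor.OsaPoint) {data : Array (MI × Array MI × Array MI)},
      UniversalFactor.osaAllPointData C pts = some data →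
      ∀ (k : ℕ) (pt : UniversalFactor.OsaPoint) (d : MI × Array MI × Array MI),
        pts[k]? = some pt → data[k]? = some d → UniversalFactor.osaPointData C pt = some d
  | [], data, h, k, pt, d, hk, _ => by simp at hk
  | p :: rest, data, h, k, pt, d, hk, hd => by
      simp only [UniversalFactor.osaAllPointData] at h
      split at h
      · rename_i d0 arr hd0 harr
        simp only [Option.some.injEq] at h
        subst h
        cases k with
        | zero =>
          simp at hk hd
          subst hk; subst hd; exact hd0
        | succ k =>
          simp only [List.getElem?_cons_succ] at hk
          have hd' : arr[k]? = some d := by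
            simpa [Array.getElem?_append] using hd
          exact UniversalFactor.osaAllPointData_get rest harr k pt d hk hd'
      · simp at h

/-- The boxes check, unpacked: every box `k < n` passes at its assigned point. [folklore] -/
theorem UniversalFactor.osaBoxesCheck_get {C : UniversalFactor.OsaCtx} {pts : List UniversalFactor.OsaPoint}
    {data : Array (MI × Array MI × Array MI)} {As asg : List ℕ} {AD : ℕ} :
    ∀ n : ℕ, UniversalFactor.osaBoxesCheck C pts data As asg AD n = true →
      ∀ k < n, ∃ (pt : UniversalFactor.OsaPoint) (d : MI × Array MI × Array MI),
        pts[asg.getD k 0]? = some pt ∧ data[asg.getD k 0]? = some d ∧ As.getD k 0 < As.getD (k + 1) 0 ∧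
        UniversalFactor.osaBoxCheck C pt d.1 d.2.1 d.2.2 (As.getD k 0) (As.getD (k + 1) 0) AD = true
  | 0, _, k, hk => absurd hk (Nat.not_lt_zero _)
  | n + 1, h, k, hk => by
      simp only [UniversalFactor.osaBoxesCheck, Bool.and_eq_true] at h
      obtain ⟨hrec, hlast⟩ := h
      rcases Nat.lt_succ_iff_lt_or_eq.1 hk with hlt | heq
      · exact UniversalFactor.osaBoxesCheck_get n hrec k hlt
      · subst heq
        split at hlast
        · rename_i pt hx vB vF hpt hd
          simp only [Bool.and_eq_true, decide_eq_true_eq] at hlast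
          exact ⟨pt, (hx, vB, vF), hpt, hd, hlast.1, hlast.2⟩
        · simp at hlast

/-- Consecutive boxes cover the window: every `a ∈ [As₀/AD, As_m/AD]` (`m ≥ 1`) lies in some box `k < m`. [folklore] -/
theorem UniversalFactor.osa_cover_find (As : List ℕ) (AD : ℕ) (a : ℝ) (h0 : (As.getD 0 0 : ℝ) / AD ≤ a) :
    ∀ m : ℕ, 1 ≤ m → a ≤ (As.getD m 0 : ℝ) / AD →
      ∃ k < m, (As.getD k 0 : ℝ) / AD ≤ a ∧ a ≤ (As.getD (k + 1) 0 : ℝ) / AD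
  | 0, hm, _ => absurd hm (by norm_num)
  | m + 1, _, ham => by
      by_cases hle : a ≤ (As.getD m 0 : ℝ) / AD
      · rcases Nat.eq_zero_or_pos m with hm0 | hm0
        · subst hm0
          exact ⟨0, Nat.zero_lt_one, h0, ham⟩
        · obtain ⟨k, hk, h1, h2⟩ := UniversalFactor.osa_cover_find As AD a h0 m hm0 hle
          exact ⟨k, Nat.lt_succ_of_lt hk, h1, h2⟩
      · exact ⟨m, Nat.lt_succ_self m, (not_le.1 hle).le, ham⟩

/-- **Soundness of the cover check**: a passing cover of `≥ 2` breakpoints gives the dip-or-hump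
conclusion for every `a` of the window `[As₀/AD, As_last/AD]`. [folklore] -/
theorem UniversalFactor.osaCoverCheck_sound
    (hH0 : (∀ z : ℂ, ‖deBruijnH 0 z‖ ≤ ∫ u in Ioi (0:ℝ), deBruijnPhi u * Real.cosh (z.im * u)) ∧
      IntegrableOn (fun u : ℝ => deBruijnPhi u * Real.cosh (12 * u)) (Ioi 0) ∧
      (∫ u in Ioi (0:ℝ), deBruijnPhi u * Real.cosh (12 * u)) ≤ 5)
    {C : UniversalFactor.OsaCtx} (hV : C.Valid) {pts : List UniversalFactor.OsaPoint} {As asg : List ℕ} {AD : ℕ}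
    (hlen : 2 ≤ As.length) (hchk : UniversalFactor.osaCoverCheck C pts As asg AD = true)
    {a : ℝ} (hlo : (As.getD 0 0 : ℝ) / AD ≤ a) (hhi : a ≤ (As.getD (As.length - 1) 0 : ℝ) / AD) :
    ∃ x : ℝ, 0 ≤ x ∧
      (((deBruijnH 0 x).re < 0 ∧
          0 < (∫ y in Ioi (0:ℝ), deBruijnH 0 ((x : ℂ) - y) * (Real.exp (-(a * y)) : ℂ)).re ∧
          0 < (∫ y in Ioi (0:ℝ), deBruijnH 0 ((x : ℂ) + y) * (Real.exp (-(a * y)) : ℂ)).re) ∨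
        (0 < (deBruijnH 0 x).re ∧
          (∫ y in Ioi (0:ℝ), deBruijnH 0 ((x : ℂ) - y) * (Real.exp (-(a * y)) : ℂ)).re < 0 ∧
          (∫ y in Ioi (0:ℝ), deBruijnH 0 ((x : ℂ) + y) * (Real.exp (-(a * y)) : ℂ)).re < 0)) := by
  unfold UniversalFactor.osaCoverCheck at hchk
  simp only [Bool.and_eq_true, decide_eq_true_eq] at hchk
  obtain ⟨⟨hsan, hall⟩, hboxes⟩ := hchk
  obtain ⟨hAD, hA0, -⟩ := hsan
  split at hboxes
  · rename_i data hdata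
    obtain ⟨k, hk, hk1, hk2⟩ := UniversalFactor.osa_cover_find As AD a hlo (As.length - 1) (by omega) hhi
    obtain ⟨pt, d, hpt, hd, hlt, hbox⟩ := UniversalFactor.osaBoxesCheck_get _ hboxes k hk
    have hok : pt.ok = true := by
      rw [List.all_eq_true] at hall
      exact hall pt (List.mem_of_getElem? hpt)
    have hpd := UniversalFactor.osaPointData_sound hV pt hok (UniversalFactor.osaAllPointData_get pts hdata _ pt d hpt hd)
    have hAk : 0 < As.getD k 0 := by
      -- the breakpoints increase from `As₀ > 0`
      have hmono : ∀ k' ≤ k, As.getD 0 0 ≤ As.getD k' 0 := by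
        intro k' hk'
        induction k' with
        | zero => exact le_rfl
        | succ k'' ih =>
          have := (UniversalFactor.osaBoxesCheck_get _ hboxes k'' (by omega)).choose_spec.choose_spec.2.2.1
          exact (ih (by omega)).trans this.le
      exact lt_of_lt_of_le hA0 (hmono k le_rfl)
    refine ⟨(pt.xn : ℝ) / pt.xd, by positivity, ?_⟩
    have := UniversalFactor.osaBoxCheck_sound hH0 hV pt hok hpd.1 hpd.2.1 hpd.2.2 hAk hAD hbox hk1 hk2
    simpa only [Complex.ofReal_div, Complex.ofReal_natCast] using this
  · simp at hboxes

/-- **Registered sub-goal `stub_osaCoverFind`** (consecutive boxes cover the window). [folklore] -/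
theorem UniversalFactor.stub_osaCoverFind :
    ∀ (As : List ℕ) (AD : ℕ) (a : ℝ), (As.getD 0 0 : ℝ) / AD ≤ a → ∀ (m : ℕ), 1 ≤ m → a ≤ (As.getD m 0 : ℝ) / AD →
      ∃ k < m, (As.getD k 0 : ℝ) / AD ≤ a ∧ a ≤ (As.getD (k + 1) 0 : ℝ) / AD :=
  fun As AD a h0 m hm ham => UniversalFactor.osa_cover_find As AD a h0 m hm ham

end Summit.RiemannHypothesis.RiemannHypothesis.Theorems
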